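import Literature.MathematicalPhysics.QuantumFieldTheory.Balaban1983to89.B8SectEInLambdaWitnessRec
import Literature.MathematicalPhysics.QuantumFieldTheory.Balaban1983to89.B8SectERemainderCovarianceRec
import Literature.MathematicalPhysics.QuantumFieldTheory.Balaban1983to89.B7Prop10InLambdaRec

/-!
# `Balaban1983to89.B8SectERemainderCovarianceTowerRec` — RECORD TWIN of `B8SectERemainderCovariance` §4 ([Balaban1985RegularSpaces] (1.115) p. 96, p. 93 «real solutions»:
# the Sect.-E remainder `C′_j(u, ·)` under `μ ↦ −μ⋆` ON THE TOWER from a unitary `Λ_j`-witness, and AT `u₁⁻¹` for Theorem 4's inductive `u₁`)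
# FOR THE SYMMETRISED CENTRED block averaging (0.4) of [Balaban1987RG1] — the tower-local sequel of dag-n05-c's `B8SectERemainderCovarianceRec` §1–§3

statement-level skeleton of published theorems with citation tags; proofs where landed; nothing here is a claim about the Yang–Mills mass gap

T. Bałaban, *Spaces of regular gauge field configurations on a lattice and gauge fixing conditions*, Commun. Math. Phys. **99** (1985) 75–102
`[Balaban1985RegularSpaces]` ("[6]"): (1.115) p. 96, (1.120) p. 96, (1.112) p. 95, p. 93; T. Bałaban, *Averaging operations for lattice gauge theories*, Commun. Math. Phys.
**98** (1985) 17–51 `[Balaban1985Averaging]` ("[3]"): Prop. 10 p. 50, (166)–(167) p. 44, (176)–(178) p. 45, (106) p. 33, (213) p. 50; T. Bałaban, *Renormalization group approach to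
lattice gauge field theories. I*, Commun. Math. Phys. **109** (1987) 249–301 `[Balaban1987RG1]` ("[I]"): (0.3)–(0.4) pp. 252–253.  STATUS: published, refereed.

CITATION HEADER (lean-in-tree rule).  Cell `pub-ymgap`, «N05-REC» stage 2 (director-ym №254∕№255∕№288), item R5-γ (Sect. E for the record; dag-n05-c's remainder list, HANDOFF g26:
«`B8SectERemainderCovarianceRec` §4 if used») — typed by the LEAD PEN dag-n05-e g39 (inventory `N05-REC-INVENTORY.md` §R5 row `B8SectERemainderCovariance`: A
`Cnl_negStar_inv_of_axial`, `witness_inv_unitary_of_glev`, `Cnl_negStar_of_witness` — the §4 part; §1–§3 (`CnlZ_negStar`, `utilGZ_theta`, `lamAvgGZ_negStar`, `uavgZ_theta`) are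
dag-n05-c's `B8SectERemainderCovarianceRec` ✓, IMPORTED, not modified).  WHAT IS REPRODUCED = ✓ the engine module `B8SectERemainderCovariance` (seat `pub-ymgap-dag-n04-b`) §4
VERBATIM under the token map, as a NEW file (the landed record file stays byte-identical).  THEOREM NAMES = the engine's (namespace `…B8SectERemainderCovarianceTowerRec`).  TOKEN MAP:
`Cnl ∕ utilG ∕ avgIter ∕ glev ∕ InLambda ∕ InAx ∕ Restr129 ↦ CnlZ ∕ utilGZ ∕ avgIterZ ∕ glevZ ∕ InLambdaZ ∕ InAxZ ∕ Restr129Z`; tower `B8Ineq130.tlo ∕ thi ↦ B8Ineq130Rec.tlo ∕ thi`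
(CENTRED); regime `(hL : 2 ≤ L) ↦ (hLs : L = 2s+1) (hs1 : 1 ≤ s) (hd : 1 ≤ d)`, `C0 ↦ C0Z`, `2α₀ ≤ c₂′ ↦ 4α₀ ≤ c₂′`; the gauge-fixing witness constant `40d·c ↦ 20dKZ·c` with the
record smallness (`exp(4c_Zα₀)(1 + 2·131072(d+1)²KZ²c) ≤ 2`, `KZ·c ≤ c₃`, `1024·d·KZ·c ≤ 1`).  Record inputs: `B8SectERemainderCovarianceRec.CnlZ_negStar`, `B7Prop2Rec.prop2Z_unitaryUnits`,
`B7Prop10GeneralRec.prop10_generalZ_of52 ∕ levels_of52Z`, `B7Prop10InLambdaRec.inLambdaZ_mul_of_prop10_generalZ`, `B8Eq1115ConcreteRec.utilGZ_congr_tower ∕ lamAvgGZ_congr_tower`,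
`B8Eq1112QuotientRec.inLambdaZ_inv`, `B8SectEInLambdaWitnessRec.witness_unitary_of_glevZ`, `B8Eq1117KLevelRec.glevZ_on_towers_of_axial`; structure-free
`B7Eq214.ineq176_of_207 ∕ ineq177_of_207` REUSED BY NAME.  Kind «kernel-checked proof», theorems only; no `def`, no `instance`, no `notation`, no existing module modified.
`--supports stmt-QuantumFields-20541` (K0⁷-keyed, COUNT-NEUTRAL).

## WHAT IS CERTIFIED HERE (kernel; axioms `propext` ∕ `Classical.choice` ∕ `Quot.sound`)
* `Cnl_negStar_of_witness` — `C′_m(u, −μ⋆)(z) = −C′_m(u, μ)(z)⋆` on the centred tower for any `u` with a UNITARY `Λ_j`-witness, record structure.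
* `witness_inv_unitary_of_glev` — a UNITARY `Λ_j`-witness for `(glevZ_j)⁻¹` (constant `20dKZ·c`).
* `Cnl_negStar_inv_of_axial` — the binder `hCequiv` of the record Prop-5 join: `C′_j(u₁⁻¹, −μ⋆)(y) = −C′_j(u₁⁻¹, μ)(y)⋆` for Theorem 4's inductive `u₁`.

HONEST SCOPE: the engine's proofs verbatim under the token map; nothing of Bałaban's analysis newly proved; `HThm4Rec` UNDISCHARGED; caveat (C-S3-1) + addendum v4 stand; N05 [B8]
DISCHARGED OF RECORD untouched; N05 ∕ N07 NOT discharged; COUNT of record unmoved · K numerically unchanged; one finite `𝕋⁴` programme at fixed `ε`, Bałaban AS PRINTED; nothing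
continuum ∕ ℝ⁴ ∕ OS ∕ mass-gap ∕ Clay.  No `sorry`, no `def`.

[cite: Balaban1985RegularSpaces, (1.115) p.96, (1.120) p.96, (1.112) p.95, p.93; Balaban1985Averaging, Proposition 10 p.50, (166)–(167) p.44, (176)–(178) p.45, (106) p.33;
Balaban1987RG1, (0.3)–(0.4) pp.252–253]
-/

noncomputable section

open NormedSpace Finset

namespace Literature.MathematicalPhysics.QuantumFieldTheory.Balaban1983to89.B8SectERemainderCovarianceTowerRec

open B7Prop1Explicit B7Prop2Explicit B7Prop3Flat B7Prop1Local
open MatrixLog (mlog exp_mlog)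
open B7Eq170Flat (cj cj_apply val_Rc_eq_cj)
open B7Eq92Concrete (Rc mgauge)
open B7Eq78Linearization (QprimeIter)
open B7Prop9Flat (C5' SiteBd)
open B7Prop9General (CovBondBd)
open B7Prop10General (C6 C4G)
open B7Prop10Flat (one_le_C5 C4'_nonneg C5'_nonneg)
open B8Ineq130 (inBox_of_le)
open B8Ineq130Rec (tlo thi tlo_le_thi tlo_zero thi_zero)
open B7Prop2Rec (AvgClosedZ C0Z avgClosedZ_unitaryUnits prop2Z_unitaryUnits)
open B7Prop4GeneralLevelsRec (cZ KZ gZ_nonneg)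
open BlockAveragingZd (avgIterZ)
open B7SectCDGaugeAveragesRec (glevZ)
open B7SectEFLinearisationRec (InLambdaZ utilGZ lamAvgGZ zdBlockingZ bgTZ)
open B7Prop10GeneralRec (prop10_generalZ_of52 levels_of52Z)
open B7Prop10InLambdaRec (inLambdaZ_mul_of_prop10_generalZ)
open B8Eq1115ConcreteRec (utilGZ_congr_tower lamAvgGZ_congr_tower)
open B8Eq119TwistedAxialRec (InAxZ Restr129Z)
open B8Eq178AveragesRec (QnlZ QnlZ_eq_mlog_utilGZ qprimeIter_bgTZ_eq_lamAvgGZ)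
open B8Eq1123ConcreteRec (CnlZ)
open B8Eq1112QuotientRec (inLambdaZ_inv)
open B8Eq1117KLevelRec (glevZ_on_towers_of_axial)
open B8SectERemainderCovarianceRec (CnlZ_negStar)
open B8SectEInLambdaWitnessRec (witness_unitary_of_glevZ)

-- `Site` alone could resolve to the torus sites of `Setup.lean`; re-export the `ℤ^d` sites of `B7Prop1Explicit`.
export B7Prop1Explicit (Site)

variable {d : ℕ}
variable {𝔸 : Type*} [CStarAlgebra 𝔸]

/-! ## §4 On the tower from a unitary `Λ_j`-witness; at `u₁⁻¹` for Theorem 4's inductive `u₁` -/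

section Tower

variable [Nontrivial 𝔸]
variable {L s : ℕ} {j : ℕ} {y : Site d} {U₀ : Site d → Fin d → 𝔸ˣ} {α₀ α₃ α₄ : ℝ} {μ : Site d → 𝔸} {u ut : Site d → 𝔸ˣ}

/-- **`C′_j(u, −μ⋆)(y′) = −C′_j(u, μ)(y′)⋆` ON THE TOWER FOR ANY `u` WITH A UNITARY `Λ_j`-WITNESS** — at every level-`m` site `z` of `Bⁿ(y)`
(`n + m = j`), for `μ` with (207) on `Bʲ(y)` (`‖μ‖ < α₄`, covariant differences `< α₄L^{−j}`), `U₀` unitary with (1.33) on `Bʲ(y)`, and r04's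
Prop-10 windows at `(α₃, 4α₄)` with `2C₆(α₃ + 4α₄) ≤ 1/8`, `4C₆α₄ ≤ 1/8`: the global law `Cnl_negStar` for the clamped data `(π^*U₀, μ∘π, ũ)`
(unitary levels by Prop. 2, (167) for `ũ` and for `e^{μ∘π}ũ` by [3] p. 45, (204) by Prop. 10), transferred by the locality of `ũ′ᵐ` and `Q′_m`.
[cite: Balaban1985RegularSpaces, (1.115) p.96, (1.120) p.96; Balaban1985Averaging, Prop. 10 p.50, (166)–(167) p.44] -/
theorem Cnl_negStar_of_witness (hLs : L = 2 * s + 1) (hs1 : 1 ≤ s) (hd : 1 ≤ d) (hU₀ : ∀ x κ, U₀ x κ ∈ unitaryUnits 𝔸)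
    (hα : 0 < α₀) (hα3 : C0Z d * α₀ ≤ 1 / 3) (hα4 : 4 * α₀ ≤ c2' d L)
    (h33 : pdevOn (tlo L y j) (thi L y j) U₀ < α₀ * (((L : ℝ) ^ j)⁻¹) ^ 2) (hL1 : 1 ≤ L)
    (hut : ∀ x, ut x ∈ unitaryUnits 𝔸)
    (hW : InLambdaZ L (clampCfg (tlo L y j) (thi L y j) U₀) ut j α₃ (((L : ℝ) ^ j)⁻¹))
    (hu : ∀ x : Site d, tlo L y j ≤ x → x ≤ thi L y j → u x = ut x)
    (hα₄ : 0 < α₄) (h177b : ∀ x : Site d, InBox (tlo L y j) (thi L y j) x → ‖μ x‖ < α₄)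
    (h177a : ∀ (x : Site d) (κ : Fin d), InBox (tlo L y j) (thi L y j) x → InBox (tlo L y j) (thi L y j) (x + e κ) →
      ‖cj (U₀ x κ) (μ (x + e κ)) - μ x‖ < α₄ * ((L : ℝ) ^ j)⁻¹)
    (hα₃ : 0 ≤ α₃) (hα₃' : α₃ ≤ 1 / 50)
    (hs₁ : 10 * C6 d * (4 * α₄) ≤ 1) (hs₂ : 3000 * ((d : ℝ) + 1) * L * (4 * α₄) ≤ 1) (hs₃ : C4G d L * (α₀ + α₃ + 4 * α₄) ≤ 1)
    (hs₄ : 1024 * ((d : ℝ) + 1) * ((d : ℝ) + 4) * L ^ 2 * α₀ ≤ 1) (hs₅ : 32 * ((d : ℝ) + 1) ^ 2 * C6 d * L ^ 2 * α₀ ≤ 1)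
    (hs₆ : 16 * d * C5' d * C6 d * (L : ℝ) ^ 2 * α₀ ≤ 1)
    (hprod : 2 * C6 d * (α₃ + 4 * α₄) ≤ 1 / 8) (h204w : C6 d * (4 * α₄) ≤ 1 / 8)
    {m n : ℕ} (hmn : n + m = j) (z : Site d) (hz : tlo L y n ≤ z) (hz' : z ≤ thi L y n) :
    CnlZ L U₀ u m (fun x => -star (μ x)) z = -star (CnlZ L U₀ u m μ z) := by
  have hG := avgClosedZ_unitaryUnits d L (𝔸 := 𝔸)
  have hL : 2 ≤ L := by omega
  have hlohi : ∀ i, tlo L y j i ≤ thi L y j i := tlo_le_thi L le_rfl j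
  have hUU : ∀ x κ, U₀ x κ ∈ U1 𝔸 := fun x κ => unitaryUnits_le_U1 (hU₀ x κ)
  have hLr : (1 : ℝ) ≤ L := by exact_mod_cast hL1
  have hLj : (0 : ℝ) < (L : ℝ) ^ j := by positivity
  have hC6 : (2 : ℝ) ≤ C6 d := by unfold C6; linarith [one_le_C5 (d := d)]
  have hα₄' : α₄ ≤ 1 / 4 := by nlinarith
  -- the extended data
  set U₀c := clampCfg (tlo L y j) (thi L y j) U₀ with hU₀c_def
  set μc : Site d → 𝔸 := fun x => μ (clamp (tlo L y j) (thi L y j) x) with hμc_def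
  have hU₀c : ∀ x κ, U₀c x κ ∈ unitaryUnits 𝔸 := clampCfg_mem hU₀
  have h52c : pdev U₀c < α₀ * (((L : ℝ) ^ j)⁻¹) ^ 2 := (pdev_clampCfg_le hlohi hUU).trans_lt h33
  have h₀ : AgreeOn (tlo L y j) (thi L y j) U₀ U₀c := (clampCfg_agree U₀).symm
  -- unitary averaged levels of the clamped background (Prop. 2 of [3])
  have hV : ∀ i < j, ∀ (x : Site d) (κ : Fin d), avgIterZ L U₀c i x κ ∈ unitaryUnits 𝔸 := fun i hi x κ =>
    (prop2Z_unitaryUnits L hL j U₀c hU₀c hα hα3 (by linarith) h52c).2 i hi.le x κ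
  -- (167) for the witness and for the product `e^{μ∘π}·ũ`; (204) for `(e^{μ∘π}, ũ)`
  have hη : (0 : ℝ) ≤ ((L : ℝ) ^ j)⁻¹ := by positivity
  have hk : (L : ℝ) ^ j * ((L : ℝ) ^ j)⁻¹ ≤ 1 := by rw [mul_inv_cancel₀ hLj.ne']
  obtain ⟨h176, h177⟩ : SiteBd (fun x => expUnit (μc x)) (4 * α₄) ∧ CovBondBd U₀c (fun x => expUnit (μc x)) (4 * α₄ * ((L : ℝ) ^ j)⁻¹) := by
    have hη1 : ((L : ℝ) ^ j)⁻¹ ≤ 1 := inv_le_one_of_one_le₀ (one_le_pow₀ hLr)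
    have hb : ∀ x : Site d, ‖μc x‖ < α₄ := fun x => h177b _ (clamp_inBox hlohi x)
    have ha : ∀ (x : Site d) (κ : Fin d), ‖cj (U₀c x κ) (μc (x + e κ)) - μc x‖ < α₄ * ((L : ℝ) ^ j)⁻¹ := by
      intro x κ
      by_cases hP : tlo L y j κ ≤ x κ ∧ x κ < thi L y j κ
      · have hx := clamp_inBox hlohi x
        have hxe : InBox (tlo L y j) (thi L y j) (clamp (tlo L y j) (thi L y j) x + e κ) := by
          rw [← clamp_add_e_of hP]; exact clamp_inBox hlohi _
        simp only [hμc_def, hU₀c_def, clampCfg, hP, and_self, if_true, clamp_add_e_of hP]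
        exact h177a _ κ hx hxe
      · simp only [hμc_def, hU₀c_def, clampCfg, hP, if_false, clamp_add_e_of_not (hlohi κ) hP, cj_apply, Units.val_one, inv_one, one_mul,
          mul_one, sub_self, norm_zero]
        positivity
    refine ⟨fun x => ?_, fun x κ => ?_⟩
    · show ‖((expUnit (μc x) : 𝔸ˣ) : 𝔸) - 1‖ ≤ 4 * α₄
      rw [val_expUnit]
      exact (B7Eq214.ineq176_of_207 _ hα₄' (hb x)).le
    · show ‖((((expUnit (μc x))⁻¹ * Rc (U₀c x κ) (expUnit (μc (x + e κ))) : 𝔸ˣ)) : 𝔸) - 1‖ ≤ 4 * α₄ * ((L : ℝ) ^ j)⁻¹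
      rw [Units.val_mul, val_inv_expUnit, val_Rc_eq_cj, val_expUnit, val_expUnit, cj_apply]
      exact (B7Eq214.ineq177_of_207 _ _ _ hα₄' hη1 (hb x) (ha x κ)).le
  obtain ⟨hVl, hPl⟩ := levels_of52Z hL hG hU₀c j hα hα3 hα4 h52c
  have hΛprod := inLambdaZ_mul_of_prop10_generalZ hLs hs1 hd (fun i hi => hVl i hi.le) (fun i hi => hPl i hi.le) h176 h177 hW hη hk hα.le hα₃
    hα₃' (by positivity) hs₁ hs₂ hs₃ hs₄ hs₅ hs₆
  have hP10 := prop10_generalZ_of52 hLs hs1 hd hG hU₀c hα hα3 hα4 h52c h176 h177 hW hα₃ hα₃' (by positivity) hs₁ hs₂ hs₃ hs₄ hs₅ hs₆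
  have h204 : ∀ i ≤ j, ∀ x : Site d, ‖((utilGZ L U₀c (fun x => expUnit (μc x)) ut i x : 𝔸ˣ) : 𝔸) - 1‖ ≤ 1 / 8 :=
    fun i hi x => ((hP10 i hi).2 x).trans h204w
  have hsβ : α₃ * (L : ℝ) ^ j * ((L : ℝ) ^ j)⁻¹ ≤ 1 / 4 := by
    rw [mul_assoc, mul_inv_cancel₀ hLj.ne', mul_one]; linarith
  have hsβ' : 2 * C6 d * (α₃ + 4 * α₄) * (L : ℝ) ^ j * ((L : ℝ) ^ j)⁻¹ ≤ 1 / 8 := by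
    rw [mul_assoc, mul_inv_cancel₀ hLj.ne', mul_one]; exact hprod
  -- the GLOBAL law for the clamped data
  have hglob := CnlZ_negStar hV hut hW.2 hΛprod.2 hL1 hη hα₃ (by positivity) hsβ hsβ' h204 m (by omega) z
  -- transfer to the original data on the tower
  have hC : ∀ {ν νc : Site d → 𝔸}, (∀ x : Site d, tlo L y j ≤ x → x ≤ thi L y j → ν x = νc x) →
      CnlZ L U₀ u m ν z = CnlZ L U₀c ut m νc z := by
    intro ν νc hν
    have hu' : ∀ x : Site d, tlo L y j ≤ x → x ≤ thi L y j → (fun x => expUnit (ν x)) x = (fun x => expUnit (νc x)) x :=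
      fun x hx hx' => by simp only [hν x hx hx']
    simp only [CnlZ, QnlZ_eq_mlog_utilGZ]
    rw [qprimeIter_bgTZ_eq_lamAvgGZ L U₀ ν m, qprimeIter_bgTZ_eq_lamAvgGZ L U₀c νc m,
      utilGZ_congr_tower hLs h₀ hu' hu m n hmn z hz hz', lamAvgGZ_congr_tower hLs h₀ hν m n hmn z hz hz']
  have hμ : ∀ x : Site d, tlo L y j ≤ x → x ≤ thi L y j → μ x = μc x :=
    fun x hx hx' => by simp only [hμc_def, clamp_of_inBox (inBox_of_le hx hx')]
  have hμ' : ∀ x : Site d, tlo L y j ≤ x → x ≤ thi L y j → (fun x => -star (μ x)) x = (fun x => -star (μc x)) x :=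
    fun x hx hx' => by simp only [hμ x hx hx']
  rw [hC hμ', hC hμ]
  exact hglob

/-- **A UNITARY `Λ_j`-WITNESS FOR `(glev_j)⁻¹`** (`witness_unitary_of_glev` inverted, keeping the unitarity that `B8SectEInLambdaWitness.witness_inv_of_glev`
does not export): for `u₁ = glev_j` on `Bʲ(y)` (unitary data, windows as there), `u₁⁻¹` agrees on `Bʲ(y)` with a global UNITARY member of
`Λ_j(π^*U₀, 40d·c)`. [cite: Balaban1985RegularSpaces, (1.112) p.95; Balaban1985Averaging, (106) p.33, (166)–(167) p.44] -/
theorem witness_inv_unitary_of_glev {c αP : ℝ} {B : Site d → Fin d → 𝔸} (hLs : L = 2 * s + 1) (hs1 : 1 ≤ s) (hd : 1 ≤ d)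
    (hU₀ : ∀ x κ, U₀ x κ ∈ unitaryUnits 𝔸)
    (hα : 0 < α₀) (hα3 : C0Z d * α₀ ≤ 1 / 3) (hα4 : 4 * α₀ ≤ c2' d L)
    (h33 : pdevOn (tlo L y j) (thi L y j) U₀ < α₀ * (((L : ℝ) ^ j)⁻¹) ^ 2) (hc : 0 ≤ c)
    (hsmall : Real.exp (4 * cZ d * α₀) * (1 + 2 * (131072 * ((d : ℝ) + 1) ^ 2) * (KZ d L) ^ 2 * c) ≤ 2)
    (hc₃ : KZ d L * c ≤ c3 d L) (hsm : 1024 * (d : ℝ) * KZ d L * c ≤ 1)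
    (hαP : 0 < αP) (hαP3 : C0Z d * αP ≤ 1 / 3) (hαP2 : 2 * αP ≤ c2' d L) (hL1 : 1 ≤ L)
    (hBu : ∀ (x : Site d) (κ : Fin d), expCfg B x κ ∈ unitaryUnits 𝔸)
    (h69 : ∀ (x : Site d) (κ : Fin d), InBox (tlo L y j) (thi L y j) x → InBox (tlo L y j) (thi L y j) (x + e κ) →
      ‖B x κ‖ ≤ c * ((L : ℝ) ^ j)⁻¹)
    (hP : pdevOn (tlo L y j) (thi L y j) (expCfg B * U₀) < αP * (((L : ℝ) ^ j)⁻¹) ^ 2) {u₁ : Site d → 𝔸ˣ}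
    (hu₁ : ∀ x : Site d, tlo L y j ≤ x → x ≤ thi L y j → u₁ x = glevZ L hL1 U₀ (expCfg B) j 0 x) :
    ∃ ut' : Site d → 𝔸ˣ, (∀ x, ut' x ∈ unitaryUnits 𝔸) ∧
      InLambdaZ L (clampCfg (tlo L y j) (thi L y j) U₀) ut' j (20 * d * KZ d L * c) (((L : ℝ) ^ j)⁻¹) ∧
      ∀ x : Site d, tlo L y j ≤ x → x ≤ thi L y j → u₁⁻¹ x = ut' x := by
  have hL : 2 ≤ L := by omega
  obtain ⟨ut, hun, hΛ, hag⟩ := witness_unitary_of_glevZ hLs hs1 hd hU₀ hα hα3 hα4 h33 hc hsmall hc₃ hsm hαP hαP3 hαP2 hL1 hBu h69 hP hu₁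
  have hlohi : ∀ i, tlo L y j i ≤ thi L y j i := tlo_le_thi L le_rfl j
  have hUU : ∀ x κ, U₀ x κ ∈ U1 𝔸 := fun x κ => unitaryUnits_le_U1 (hU₀ x κ)
  have hLj : (0 : ℝ) < (L : ℝ) ^ j := by positivity
  have hU₀c : ∀ x κ, clampCfg (tlo L y j) (thi L y j) U₀ x κ ∈ unitaryUnits 𝔸 := clampCfg_mem hU₀
  have h52c : pdev (clampCfg (tlo L y j) (thi L y j) U₀) < α₀ * (((L : ℝ) ^ j)⁻¹) ^ 2 := (pdev_clampCfg_le hlohi hUU).trans_lt h33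
  have hV : ∀ i < j, ∀ (x : Site d) (κ : Fin d), avgIterZ L (clampCfg (tlo L y j) (thi L y j) U₀) i x κ ∈ unitaryUnits 𝔸 :=
    fun i hi x κ => (prop2Z_unitaryUnits L hL j _ hU₀c hα hα3 (by linarith) h52c).2 i hi.le x κ
  have hK : 0 ≤ KZ d L := by unfold KZ; have := gZ_nonneg d L; positivity
  have h40 : 20 * (d : ℝ) * KZ d L * c ≤ 1 / 4 := by
    have h0 : 0 ≤ (d : ℝ) * KZ d L * c := by positivity
    nlinarith [hsm, h0]
  have hs : 20 * (d : ℝ) * KZ d L * c * (L : ℝ) ^ j * ((L : ℝ) ^ j)⁻¹ ≤ 1 / 4 := by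
    rw [mul_assoc, mul_inv_cancel₀ hLj.ne', mul_one]; exact h40
  refine ⟨ut⁻¹, fun x => ?_, inLambdaZ_inv hV hun hΛ hL1 (by positivity) (by positivity) hs, fun x hx hx' => ?_⟩
  · rw [Pi.inv_apply]; exact (unitaryUnits 𝔸).inv_mem (hun x)
  · rw [Pi.inv_apply, Pi.inv_apply, hag x hx hx']

/-- **THE BINDER `hCequiv` OF `B8Prop5JoinSectE.hFP_kLevel_of_sectE` AS A THEOREM**: for Theorem 4's inductive `u₁` (`U₁^{u₁}U₀ ∈ Ax_k(𝔅_k, U₀)`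
and (1.29): `InAx`, `Restr129`; `U₁ = e^{B}` unitary-valued with (1.69) on the towers; `U₀` unitary with (1.33) on the towers; the full
gauge-fixed field's regularity `αP`; windows), at every `j ≤ k`, `y ∈ Λ_j` and every `μ` in the (1.120)-set of the tower `Bʲ(y)`:
`C′_j(u₁⁻¹, −μ⋆)(y) = −C′_j(u₁⁻¹, μ)(y)⋆`. [cite: Balaban1985RegularSpaces, (1.115) p.96, (1.120) p.96, p.93, (1.112) p.95; Balaban1985Averaging, Prop. 10 p.50] -/
theorem Cnl_negStar_inv_of_axial {k : ℕ} (Λ : ℕ → Set (Site d)) {c αP : ℝ} {B : Site d → Fin d → 𝔸} {u₁ : Site d → 𝔸ˣ}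
    (hLs : L = 2 * s + 1) (hs1 : 1 ≤ s) (hd : 1 ≤ d) (hL1 : 1 ≤ L) (hU₀ : ∀ x κ, U₀ x κ ∈ unitaryUnits 𝔸)
    (hα : 0 < α₀) (hα3 : C0Z d * α₀ ≤ 1 / 3) (hα4 : 4 * α₀ ≤ c2' d L) (hc : 0 ≤ c) (hα₄ : 0 < α₄)
    (hαP : 0 < αP) (hαP3 : C0Z d * αP ≤ 1 / 3) (hαP2 : 2 * αP ≤ c2' d L)
    (hBu : ∀ (x : Site d) (κ : Fin d), expCfg B x κ ∈ unitaryUnits 𝔸)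
    (h33 : ∀ j, j ≤ k → ∀ y ∈ Λ j, pdevOn (tlo L y j) (thi L y j) U₀ < α₀ * (((L : ℝ) ^ j)⁻¹) ^ 2)
    (h69 : ∀ j, j ≤ k → ∀ y ∈ Λ j, ∀ (x : Site d) (κ : Fin d), InBox (tlo L y j) (thi L y j) x →
      InBox (tlo L y j) (thi L y j) (x + e κ) → ‖B x κ‖ ≤ c * ((L : ℝ) ^ j)⁻¹)
    (hP : ∀ j, j ≤ k → ∀ y ∈ Λ j, pdevOn (tlo L y j) (thi L y j) (expCfg B * U₀) < αP * (((L : ℝ) ^ j)⁻¹) ^ 2)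
    (hAx : InAxZ L k Λ U₀ (mgauge U₀ u₁ (expCfg B) * U₀)) (h129 : Restr129Z L k Λ U₀ u₁)
    (hsmall : Real.exp (4 * cZ d * α₀) * (1 + 2 * (131072 * ((d : ℝ) + 1) ^ 2) * (KZ d L) ^ 2 * c) ≤ 2)
    (hc₃ : KZ d L * c ≤ c3 d L) (hsc : 1024 * (d : ℝ) * KZ d L * c ≤ 1) (hα₃' : 20 * d * KZ d L * c ≤ 1 / 50)
    (hs₁ : 10 * C6 d * (4 * α₄) ≤ 1) (hs₂ : 3000 * ((d : ℝ) + 1) * L * (4 * α₄) ≤ 1)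
    (hs₃ : C4G d L * (α₀ + 20 * d * KZ d L * c + 4 * α₄) ≤ 1)
    (hs₄ : 1024 * ((d : ℝ) + 1) * ((d : ℝ) + 4) * L ^ 2 * α₀ ≤ 1) (hs₅ : 32 * ((d : ℝ) + 1) ^ 2 * C6 d * L ^ 2 * α₀ ≤ 1)
    (hs₆ : 16 * d * C5' d * C6 d * (L : ℝ) ^ 2 * α₀ ≤ 1)
    (hprod : 2 * C6 d * (20 * d * KZ d L * c + 4 * α₄) ≤ 1 / 8) (h204w : C6 d * (4 * α₄) ≤ 1 / 8) :
    ∀ j, j ≤ k → ∀ y ∈ Λ j, ∀ μ : Site d → 𝔸,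
      (∀ x : Site d, InBox (tlo L y j) (thi L y j) x → ‖μ x‖ < α₄) →
      (∀ (x : Site d) (κ : Fin d), InBox (tlo L y j) (thi L y j) x → InBox (tlo L y j) (thi L y j) (x + e κ) →
        ‖cj (U₀ x κ) (μ (x + e κ)) - μ x‖ < α₄ * ((L : ℝ) ^ j)⁻¹) →
      CnlZ L U₀ u₁⁻¹ j (fun x => -star (μ x)) y = -star (CnlZ L U₀ u₁⁻¹ j μ y) := by
  intro j hj y hy μ hμb hμa
  obtain ⟨ut', hun, hW, hag⟩ := witness_inv_unitary_of_glev hLs hs1 hd hU₀ hα hα3 hα4 (h33 j hj y hy) hc hsmall hc₃ hsc hαP hαP3 hαP2 hL1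
    hBu (h69 j hj y hy) (hP j hj y hy) (glevZ_on_towers_of_axial hLs hL1 Λ hAx h129 j hj y hy)
  have hy₀ : tlo L y 0 ≤ y := by rw [tlo_zero]
  have hy₀' : y ≤ thi L y 0 := by rw [thi_zero]
  have hα₃0 : 0 ≤ 20 * (d : ℝ) * KZ d L * c := by
    have hK : 0 ≤ KZ d L := by unfold KZ; have := gZ_nonneg d L; positivity
    positivity
  exact Cnl_negStar_of_witness hLs hs1 hd hU₀ hα hα3 hα4 (h33 j hj y hy) hL1 hun hW hag hα₄ hμb hμa hα₃0 hα₃' hs₁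
    hs₂ hs₃ hs₄ hs₅ hs₆ hprod h204w (m := j) (n := 0) (by omega) y hy₀ hy₀'

end Tower

end Literature.MathematicalPhysics.QuantumFieldTheory.Balaban1983to89.B8SectERemainderCovarianceTowerRec

end
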